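import Literature.NumberTheory.EllipticCurves.Rank1Residual.Predicates
import HarnessLib

/-!
# Leaf `ClassX6 ∧ r_an = 0` — road (R2): the INERT-PAIR sub-class predicate `HasInertPair`
# (cell `bsd-print-x6`, typer seat `ty2`; PLAN v4.2 (R2), seat p3-g2 INBOX 2026-08-27T19:01:22Z; the LIGHT defs module)

HONEST FRAMING (cell `bsd-print-x6`, run/shared/lean/pub/bsd-print-x6/README.md): the cell closes the
partition leaf `ClassX6 W p ∧ W.analyticRank = 0` BY NAME from cited theorems typed exactly. THIS FILE
asserts nothing about any curve, books nothing, introduces NO named fact (debt 0) and ONE definition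
with a body — the sub-class predicate `HasInertPair W p` of the INERT-PAIR quaternionic road (R2) for the
residual child `EisensteinHalfFiveLeRest` (stmt-BirchSwinnertonDyer-21116) — plus a short API. It is the
twin of `X6RankZeroErratumDefs.lean` (`HasErratumPrime`, road (E)); like that module its import closure
is deliberately minimal (`Rank1Residual.Predicates` only), so that per-pair certificate modules
(`Rank1Residual/X6/RankZeroCertificate*.lean`, seat ty3) can decide it record by record, and the
prover-side discharge of the cited theorems' hypotheses on the sub-class lives in a sibling that imports
THIS file (not conversely).

## The road and which clause is needed by whom

Road (R2) (PLAN.md v4.2 «What would move the Rest residual CLASS-WIDE», (R2); p3-g2 INBOX 19:01:22Z):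
for `K` imaginary quadratic with exactly two primes `ℓ₁ ≠ ℓ₂` of `N` INERT and every other prime of `N`
and `p` split, the generalized Heegner hypothesis holds with `N⁻ = ℓ₁ℓ₂` (an EVEN number of inert
primes), so `w(E/K) = −1` whatever the local signs `a_{ℓ_i}` — no SIGN clause is needed (contrast
`HasErratumPrime`, whose ramified prime must be NONSPLIT); the Heegner point lives on the Shimura curve
`X_{N⁺,N⁻}` attached to the quaternion algebra ramified at `{ℓ₁, ℓ₂}`.
* `mult(ℓ₁) ∧ mult(ℓ₂)`, `ℓ₁ ≠ ℓ₂` (`ℓ₁ℓ₂ ‖ N`): (gen-H) of Castella–Wan 2024 §2 (MS p. 5) / Jetchev–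
  Skinner–Wan 2017 §4.1 (H): `N⁻` square-free with an even number of prime factors.
* `p ∤ ord_{ℓ_i}(Δ_min)` (`E[p]` RAMIFIED at `ℓ_i`, Tate): the integrality clause of Castella–Wan 2024
  Thm. 5.3 («`E[p]` is ramified at every `ℓ ∣ N⁻`», MS pp. 23–25), the Ribet–Takahashi degree comparison
  at `p`, and the Tamagawa bookkeeping at the inert primes
  (`Castella2018.TamagawaQuadratic.padicValNat_tamagawaProduct_baseChange_quadratic`: non-split bad primes
  multiplicative with `E[p]` ramified) — each consumes exactly this clause (p3-g2, loc. cit.).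
On class X6 (`p` GOOD) `ℓ_i ≠ p` is automatic (`HasInertPair.ne_of_good₁/₂`), so `HasInertPair W p`
refines the tree's `Ram W p` (`HasInertPair.ram`). A predicate on `(W, p)`; nothing asserted; decidable
per pair from Cremona data (reduction type and `ord_ℓ Δ` at each `ℓ ‖ N`). It is EMPTY on curves with
fewer than two multiplicative primes — in particular on prime conductor — and it does NOT separate the
`Rest` from the `Err` cells: NON-VACUITY / CENSUS (seat ty3, INBOX 2026-08-27T19:15:05Z, engine = the
erratum table HOME/ty3/erratum/X6R0-ERRATUM-v1.tsv of the 734 A6 rank-zero records): `HasInertPair W p`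
holds on 113/113 non-unit census records at `p ≥ 5` (all 6 `Rest` cells — e.g. `12927e1 @ 7`, bad primes
`3, 31, 139`, all with `7 ∤ ord_ℓ Δ` — and all 107 `Err` cells) and on 574/621 at `p = 3` (record only;
road (R2)'s printed inputs need `p ≥ 5`). The kernel twin of that count is ty3's certificate module
(`Rank1Residual/X6/RankZeroCertificateInertPair.lean`, announced), importing THIS file.

References: [CastellaWan2023] §2 (MS p. 5), Thm. 5.3 (MS pp. 23–25); [JetchevSkinnerWan2017] §4.1 (H)
(arXiv:1512.06894 p. 17), §7.4.2 (p. 31); [SkinnerUrban2014] Thm. 2; `Rank1Residual/Predicates.lean`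
(`Ram`, `Mult`, `Good`); sibling `X6RankZeroErratumDefs.lean`.
-/

set_option autoImplicit false

open WeierstrassCurve Literature.NumberTheory.EllipticCurves
  Literature.NumberTheory.EllipticCurves.Rank1Residual

namespace Summit.BirchSwinnertonDyer.Rank1Residual.Supersingular

section Predicate

/-- **The inert-pair sub-class** (road (R2) for the `Rest` residual): `E` has two DISTINCT primes
`ℓ₁, ℓ₂` of multiplicative reduction (`ℓ₁ℓ₂ ‖ N`) at each of which `E[p]` is RAMIFIED
(`p ∤ ord_{ℓ_i}(Δ_min)`, Tate) — the locus on which an imaginary quadratic field with `ℓ₁, ℓ₂` inert and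
every other prime of `N` and `p` split satisfies the generalized Heegner hypothesis with `N⁻ = ℓ₁ℓ₂`
(`w(E/K) = −1` for any local signs) and Castella–Wan 2024 Thm. 5.3's integrality clause «`E[p]` ramified
at every `ℓ ∣ N⁻`» holds verbatim. A predicate on `(W, p)`; nothing asserted; decidable per pair.
[cite: CastellaWan2023, §2 (gen-H) (MS p. 5) and Thm. 5.3 (MS pp. 23–25) (shape only; nothing asserted)]
[cite: JetchevSkinnerWan2017, §4.1 (H) (arXiv:1512.06894 p. 17) (shape only; nothing asserted)]
[cite: SkinnerUrban2014, Thm. 2 (p. 3), second bullet (the (ram) clause)] -/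
def HasInertPair (W : WeierstrassCurve ℚ) [W.IsGloballyMinimal] (p : ℕ) : Prop :=
  ∃ ℓ₁ ℓ₂ : ℕ, ∃ _ : Fact ℓ₁.Prime, ∃ _ : Fact ℓ₂.Prime, ℓ₁ ≠ ℓ₂ ∧
    W.HasMultiplicativeReductionAtPrime ℓ₁ ∧ W.HasMultiplicativeReductionAtPrime ℓ₂ ∧
    ¬ p ∣ padicValInt ℓ₁ W.minimalDiscriminantInt ∧ ¬ p ∣ padicValInt ℓ₂ W.minimalDiscriminantInt

variable {W : WeierstrassCurve ℚ} [W.IsGloballyMinimal] {p : ℕ}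

/-- Introduction rule: two distinct multiplicative primes with `p ∤ ord_{ℓ_i}(Δ_min)` witness
`HasInertPair W p` (the shape of the per-pair certificate: reduction type and `ord_ℓ Δ` at two primes
`ℓ ‖ N`). [folklore] -/
theorem hasInertPair_of_mult_of_mult (ℓ₁ ℓ₂ : ℕ) [Fact ℓ₁.Prime] [Fact ℓ₂.Prime] (hne : ℓ₁ ≠ ℓ₂)
    (h₁ : Mult W ℓ₁) (h₂ : Mult W ℓ₂) (hram₁ : ¬ p ∣ padicValInt ℓ₁ W.minimalDiscriminantInt)
    (hram₂ : ¬ p ∣ padicValInt ℓ₂ W.minimalDiscriminantInt) : HasInertPair W p :=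
  ⟨ℓ₁, ℓ₂, ‹_›, ‹_›, hne, h₁, h₂, hram₁, hram₂⟩

/-- The predicate is symmetric in the pair: a witness `(ℓ₁, ℓ₂)` may be reordered with `ℓ₁ < ℓ₂`
(normal form of the per-pair certificate). [folklore] -/
theorem HasInertPair.exists_lt (h : HasInertPair W p) :
    ∃ ℓ₁ ℓ₂ : ℕ, ∃ _ : Fact ℓ₁.Prime, ∃ _ : Fact ℓ₂.Prime, ℓ₁ < ℓ₂ ∧
      Mult W ℓ₁ ∧ Mult W ℓ₂ ∧
      ¬ p ∣ padicValInt ℓ₁ W.minimalDiscriminantInt ∧ ¬ p ∣ padicValInt ℓ₂ W.minimalDiscriminantInt := by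
  obtain ⟨ℓ₁, ℓ₂, i₁, i₂, hne, h₁, h₂, hr₁, hr₂⟩ := h
  rcases lt_or_gt_of_ne hne with hlt | hgt
  · exact ⟨ℓ₁, ℓ₂, i₁, i₂, hlt, h₁, h₂, hr₁, hr₂⟩
  · exact ⟨ℓ₂, ℓ₁, i₂, i₁, hgt, h₂, h₁, hr₂, hr₁⟩

omit [W.IsGloballyMinimal] in
/-- A multiplicative prime differs from any GOOD prime `p` (multiplicative ≠ good). [folklore] -/
theorem ne_of_good_of_mult [Fact p.Prime] (hgood : Good W p) {ℓ : ℕ} [Fact ℓ.Prime]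
    (hℓ : Mult W ℓ) : ℓ ≠ p := by
  rintro rfl
  exact WeierstrassCurve.HasMultiplicativeReduction.not_hasGoodReduction (R := ℤ_[ℓ]) hℓ hgood

/-- At a GOOD prime `p`, both primes of an inert-pair witness differ from `p`. [folklore] -/
theorem HasInertPair.exists_ne_of_good [Fact p.Prime] (h : HasInertPair W p) (hgood : Good W p) :
    ∃ ℓ₁ ℓ₂ : ℕ, ∃ _ : Fact ℓ₁.Prime, ∃ _ : Fact ℓ₂.Prime, ℓ₁ ≠ ℓ₂ ∧ ℓ₁ ≠ p ∧ ℓ₂ ≠ p ∧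
      Mult W ℓ₁ ∧ Mult W ℓ₂ ∧
      ¬ p ∣ padicValInt ℓ₁ W.minimalDiscriminantInt ∧ ¬ p ∣ padicValInt ℓ₂ W.minimalDiscriminantInt := by
  obtain ⟨ℓ₁, ℓ₂, i₁, i₂, hne, h₁, h₂, hr₁, hr₂⟩ := h
  exact ⟨ℓ₁, ℓ₂, i₁, i₂, hne, ne_of_good_of_mult hgood h₁, ne_of_good_of_mult hgood h₂, h₁, h₂, hr₁, hr₂⟩

/-- **`HasInertPair` refines the tree's (ram)**: at a GOOD prime `p`, either prime of the pair is a
multiplicative `ℓ ≠ p` with `p ∤ ord_ℓ(Δ_min)`, i.e. `Ram W p` (Skinner–Urban 2014 Thm. 2, second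
bullet). [cite: SkinnerUrban2014, Thm. 2 (p. 3), second bullet] -/
theorem HasInertPair.ram [Fact p.Prime] (h : HasInertPair W p) (hgood : Good W p) : Ram W p := by
  obtain ⟨ℓ₁, -, i₁, -, -, h₁, -, hr₁, -⟩ := h
  exact ⟨ℓ₁, i₁, ne_of_good_of_mult hgood h₁, h₁, hr₁⟩

/-- Projection to the (gen-H) data alone: two distinct multiplicative primes (all that the SIGN
`w(E/K) = −1` and the Shimura-curve level `N⁻ = ℓ₁ℓ₂` consume). [folklore] -/
theorem HasInertPair.exists_pair_mult (h : HasInertPair W p) :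
    ∃ ℓ₁ ℓ₂ : ℕ, ∃ _ : Fact ℓ₁.Prime, ∃ _ : Fact ℓ₂.Prime, ℓ₁ ≠ ℓ₂ ∧ Mult W ℓ₁ ∧ Mult W ℓ₂ := by
  obtain ⟨ℓ₁, ℓ₂, i₁, i₂, hne, h₁, h₂, -, -⟩ := h
  exact ⟨ℓ₁, ℓ₂, i₁, i₂, hne, h₁, h₂⟩

/-- The inert-pair sub-class is EMPTY on curves with at most one multiplicative prime: if every two
multiplicative primes coincide, `HasInertPair W p` fails (e.g. prime conductor). [folklore] -/
theorem not_hasInertPair_of_subsingleton_mult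
    (h1 : ∀ ℓ₁ ℓ₂ : ℕ, (i₁ : Fact ℓ₁.Prime) → (i₂ : Fact ℓ₂.Prime) → Mult W ℓ₁ → Mult W ℓ₂ → ℓ₁ = ℓ₂) :
    ¬ HasInertPair W p := by
  rintro ⟨ℓ₁, ℓ₂, i₁, i₂, hne, h₁, h₂, -, -⟩
  exact hne (h1 ℓ₁ ℓ₂ i₁ i₂ h₁ h₂)

end Predicate

end Summit.BirchSwinnertonDyer.Rank1Residual.Supersingular
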